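import Summits.Ventures.PercRepro.RankLevelSetFrameQ

/-!
# PercRepro — THE RANK-`≤ q` COUNT BY BASIS FIBRES (p1, gen 42; the `A`-input of the hyperplane key)

A set `X` of rank `≤ q` is a basis `I` of itself (an independent `j`-set, `j = ρ(X) ≤ q`) together with points of
`cl(I) ∖ I`; when every set of rank `≤ j` has `≤ f j` points, each independent `j`-set carries at most `2^{f j − j}`
such `X`. Hence **`#{X ⊆ E : ρ(X) ≤ q} ≤ Σ_{j ≤ q} C(n, j) · 2^{f j − j}`** (`ncard_eRk_le_le_sum_choose`). In the
`e`-free core at `q = 5` the flat bounds are `f = 0, 1, 3, 6, 10, 19` (`ncard_eRk_le_five_le_of_free`). Nothing about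
any cell is claimed here.

* `ncard_fibre_le` — the fibre `{X : I ⊆ X ⊆ cl I}` of an independent set has `≤ 2^{m − |I|}` elements when `|cl I| ≤ m`;
* `ncard_indep_ncard_eq_le_choose` — at most `C(n, j)` independent `j`-sets;
* `ncard_eRk_le_le_sum_choose` — the count;
* `ncard_eRk_le_five_le_of_free` — the `e`-free instance at `q = 5`.
Axioms: standard.
-/

open scoped Matroid

namespace PercRepro

namespace HypKey

open Set

variable {α : Type}

/-- The fibre of a set `I ⊆ E`: the sets `X` with `I ⊆ X ⊆ cl I` number at most `2^{m − |I|}` when `|cl I| ≤ m`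
(`X ↦ X ∖ I` is injective into the subsets of `cl I ∖ I`). -/
theorem ncard_fibre_le (M : Matroid α) [M.Finite] {I : Set α} (hI : I ⊆ M.E) (m : ℕ)
    (hcl : (M.closure I).ncard ≤ m) :
    {X : Set α | I ⊆ X ∧ X ⊆ M.closure I}.ncard ≤ 2 ^ (m - I.ncard) := by
  have hclfin : (M.closure I).Finite := M.ground_finite.subset (M.closure_subset_ground I)
  have hIcl : I ⊆ M.closure I := M.subset_closure I hI
  calc {X : Set α | I ⊆ X ∧ X ⊆ M.closure I}.ncard ≤ (𝒫 (M.closure I \ I)).ncard := by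
        refine ncard_le_ncard_of_injOn (fun X => X \ I) ?_ ?_ (hclfin.sdiff.finite_subsets)
        · rintro X ⟨-, hXcl⟩
          exact sdiff_subset_sdiff_left hXcl
        · rintro X ⟨hIX, -⟩ X' ⟨hIX', -⟩ h
          simp only at h
          rw [← union_sdiff_cancel hIX, h, union_sdiff_cancel hIX']
    _ = 2 ^ (M.closure I \ I).ncard := ncard_powerset _ hclfin.sdiff
    _ ≤ 2 ^ (m - I.ncard) := by
        refine Nat.pow_le_pow_right (by norm_num) ?_
        rw [ncard_sdiff' hIcl hclfin]
        omega

/-- At most `C(n, j)` independent `j`-subsets of the ground set. -/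
theorem ncard_indep_ncard_eq_le_choose (M : Matroid α) [M.Finite] (j : ℕ) :
    {I : Set α | I ⊆ M.E ∧ M.Indep I ∧ I.ncard = j}.ncard ≤ M.E.ncard.choose j := by
  rw [← ncard_powerset_ncard M.ground_finite j]
  exact ncard_le_ncard (fun I hI => ⟨hI.1, hI.2.2⟩)
    (M.ground_finite.finite_subsets.subset (fun I hI => hI.1))

/-- **THE RANK-`≤ q` COUNT.** If every set of rank `≤ j` has `≤ f j` points (`j ≤ q`), then
`#{X ⊆ E : ρ(X) ≤ q} ≤ Σ_{j ≤ q} C(n, j) · 2^{f j − j}`: every such `X` lies in the fibre of one of its bases. -/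
theorem ncard_eRk_le_le_sum_choose (M : Matroid α) [M.Finite] (q : ℕ) (f : ℕ → ℕ)
    (hf : ∀ j ≤ q, ∀ X ⊆ M.E, M.eRk X ≤ (j : ℕ∞) → X.ncard ≤ f j) :
    {X : Set α | X ⊆ M.E ∧ M.eRk X ≤ (q : ℕ∞)}.ncard ≤
      ∑ j ∈ Finset.range (q + 1), M.E.ncard.choose j * 2 ^ (f j - j) := by
  classical
  -- the independent `j`-sets as finsets
  have hfinI : ∀ j : ℕ, {I : Set α | I ⊆ M.E ∧ M.Indep I ∧ I.ncard = j}.Finite :=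
    fun j => M.ground_finite.finite_subsets.subset (fun I hI => hI.1)
  set 𝓘 : ℕ → Finset (Set α) := fun j => (hfinI j).toFinset with h𝓘
  -- the cover by fibres
  have hcover : {X : Set α | X ⊆ M.E ∧ M.eRk X ≤ (q : ℕ∞)} ⊆
      ⋃ j ∈ Finset.range (q + 1), ⋃ I ∈ 𝓘 j, {X : Set α | I ⊆ X ∧ X ⊆ M.closure I} := by
    rintro X ⟨hXE, hXq⟩
    obtain ⟨I, hI⟩ := M.exists_isBasis X hXE
    have hIX : I ⊆ X := hI.subset
    have hIE : I ⊆ M.E := hIX.trans hXE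
    have hIfin : I.Finite := M.ground_finite.subset hIE
    have hIcard : (I.ncard : ℕ∞) = M.eRk X := by
      rw [← hI.encard_eq_eRk, hIfin.cast_ncard_eq]
    have hIq : I.ncard ≤ q := by
      have : (I.ncard : ℕ∞) ≤ (q : ℕ∞) := hIcard ▸ hXq
      exact_mod_cast this
    simp only [Set.mem_iUnion, Finset.mem_range, exists_prop]
    refine ⟨I.ncard, by omega, I, ?_, hIX, hI.subset_closure⟩
    rw [h𝓘, Set.Finite.mem_toFinset]
    exact ⟨hIE, hI.indep, rfl⟩
  have hfinU : (⋃ j ∈ Finset.range (q + 1), ⋃ I ∈ 𝓘 j,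
      {X : Set α | I ⊆ X ∧ X ⊆ M.closure I}).Finite := by
    refine (Finset.range (q + 1)).finite_toSet.biUnion (fun j _ => ?_)
    refine (𝓘 j).finite_toSet.biUnion (fun I _ => ?_)
    exact M.ground_finite.finite_subsets.subset
      (fun X hX => hX.2.trans (M.closure_subset_ground I))
  calc {X : Set α | X ⊆ M.E ∧ M.eRk X ≤ (q : ℕ∞)}.ncard
      ≤ (⋃ j ∈ Finset.range (q + 1), ⋃ I ∈ 𝓘 j, {X : Set α | I ⊆ X ∧ X ⊆ M.closure I}).ncard :=
        ncard_le_ncard hcover hfinU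
    _ ≤ ∑ j ∈ Finset.range (q + 1),
          (⋃ I ∈ 𝓘 j, {X : Set α | I ⊆ X ∧ X ⊆ M.closure I}).ncard :=
        Finset.set_ncard_biUnion_le _ _
    _ ≤ ∑ j ∈ Finset.range (q + 1), M.E.ncard.choose j * 2 ^ (f j - j) := by
        refine Finset.sum_le_sum (fun j hj => ?_)
        have hjq : j ≤ q := by
          have := Finset.mem_range.1 hj
          omega
        calc (⋃ I ∈ 𝓘 j, {X : Set α | I ⊆ X ∧ X ⊆ M.closure I}).ncard
            ≤ ∑ I ∈ 𝓘 j, {X : Set α | I ⊆ X ∧ X ⊆ M.closure I}.ncard :=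
              Finset.set_ncard_biUnion_le _ _
          _ ≤ (𝓘 j).card • 2 ^ (f j - j) := by
              refine Finset.sum_le_card_nsmul _ _ _ (fun I hI => ?_)
              rw [h𝓘, Set.Finite.mem_toFinset] at hI
              obtain ⟨hIE, hIind, hIj⟩ := hI
              have hcl : (M.closure I).ncard ≤ f j := by
                refine hf j hjq (M.closure I) (M.closure_subset_ground I) ?_
                rw [M.eRk_closure_eq, hIind.eRk_eq_encard,
                  ← (M.ground_finite.subset hIE).cast_ncard_eq, hIj]
              have := ncard_fibre_le M hIE (f j) hcl
              rwa [hIj] at this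
          _ ≤ M.E.ncard.choose j * 2 ^ (f j - j) := by
              rw [smul_eq_mul]
              refine Nat.mul_le_mul_right _ ?_
              have hcard : (𝓘 j).card = {I : Set α | I ⊆ M.E ∧ M.Indep I ∧ I.ncard = j}.ncard := by
                rw [h𝓘]
                exact (ncard_eq_toFinset_card _ (hfinI j)).symm
              rw [hcard]
              exact ncard_indep_ncard_eq_le_choose M j

end HypKey

end PercRepro
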